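import Summits.RiemannHypothesis.RiemannHypothesis.Theses.WeilWindowFlow
import Summits.RiemannHypothesis.RiemannHypothesis.Theorems.WeilWindowFlowDiniLeakageRelEdgeMassLaw
import Summits.RiemannHypothesis.RiemannHypothesis.Theorems.WeilWindowFlowWindowLipschitzStubFormDomainPos
import Summits.RiemannHypothesis.RiemannHypothesis.Theorems.WeilWindowFlowWindowLipschitzStubGroundStateEnergy
import Summits.RiemannHypothesis.RiemannHypothesis.Theorems.WeilWindowFlowWindowLipschitzStubEulerLagrange
import Summits.RiemannHypothesis.RiemannHypothesis.Theorems.WeilWindowFlowWindowLipschitzStubSupBound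
import Summits.RiemannHypothesis.RiemannHypothesis.Theorems.WeilWindowFlowWindowLipschitzStubLocalizedCut
import Literature.NumberTheory.LFunctions.WeilMarkovQuadratic
import Literature.NumberTheory.LFunctions.WeilGroundState
import Literature.NumberTheory.LFunctions.WeilSemilocalCompactnessProofs
import HarnessLib.Audit

/-!
# Line `radical-shadow-slepian-edge` — skeleton for crux `WeilWindowFlow.DiniLeakage`
(item stmt-RiemannHypothesis-1038, route route-RiemannHypothesis-WeilWindowFlow; crux-plan round 1, gen 1, 2026-08-16)

Crux (BY NAME, never restated): `Summit.RiemannHypothesis.RiemannHypothesis.Theses.WeilWindowFlow.DiniLeakage`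
= `∀ b₀ A, 0 < b₀ → b₀ ≤ A → ∃ K, ∀ a ∈ [b₀, A], ∀ η δ > 0, ∃ h ∈ (0, δ), ε a − ε (a + h) ≤ h (K ε a + η)`,
`ε = Literature.NumberTheory.LFunctions.weilGroundEnergy` (lower right-Dini leakage bound, `K` uniform on compact
window ranges).  Standing disproof facts (cdisprove Disproof.lean 2026-08-15, read through its evidence notes — the
file body is not mounted in planner jails): `riemannHypothesis_of_diniLeakage` (the crux ALONE ⟹ RH: every line to it
carries an RH-strength step), `diniLeakage_iff_pos_and_lowerRightLipschitz`, `diniLeakage_iff_eta0` (η decorative),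
`diniLeakage_false_without_b0_pos` / `not_diniLeakageUniformK` (the floor `0 < b₀` is load-bearing; no uniform `K`).

## The line (idea card `radical-shadow-slepian-edge`, ideator 1; triage r1: pass ×3, merged by the panel with its twin
`coercive-mod-prolate-block`; card body itself is gate-evidence-only — reconstructed from its evidence notes, its
Sketch decl list `RadicalIdentity / GapBeyondRadical / RadicalShadow / EdgeStrengthBound / radicalToDini`, the twin
card and the three triage files)

RADICAL SHADOW.  Connes's truncated radical map `𝓔(f)(u) = u^{1/2} Σ_{n≥1} f(nu)` (arXiv:2106.01715 §3; arXiv:2602.04022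
§6) sends the first `≈ 2e^{2a}` prolate spheroidal functions of bandwidth `2πe^{2a}` (with the two Poisson conditions) to
functions `v_i` that are `Q`-ORTHOGONAL TO EVERYTHING — `(𝓔f)^(ρ) = ζ(ρ)·f̃(ρ)` vanishes at every zero, on the line or
not — so their window truncations form an explicit finite-rank NEAR-RADICAL BLOCK whose residuals are prolate TAILS, and
on whose `L²`-orthogonal complement the window form is expected to be COERCIVE OF ORDER ONE (the gap beyond the radical).
SLEPIAN EDGE.  On the block every `a`-derivative is an identity (Slepian 1964 / Fuchs 1964: `∂_c λ_n = (2/c) λ_n ψ_n(1)²`,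
edge value² `≈ c·(1 − λ_n)`), which pins the leakage envelope `−ε′/ε ≈ 8πe^{2a}` (kit j005797: Nyström prolate deficits
`log(1−χ₂) = −18.56 … −112.88` at `μ = 3 … 11`, matching Fuchs within 0.5 and Connes's `log ε(μ)` within +2…+3.3).
SHADOW ⟹ EDGE ⟹ DINI (this skeleton).  A true ground state `u` of the window `a` (exists: PROVED
`ConnesConsaniMoscovici2025_thm_3_6_holds.exists_isWeilGroundState`) splits as `u = f + w`, `f` its block component,
`w ⊥ block`.  The gap and the weak Euler–Lagrange identity (LANDED `…Theorems.WeilWindowFlowWindowLipschitz.stub_eulerLagrange`)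
make `w` the solution of a COERCIVE inhomogeneous problem whose source is the block residual, of size `√(κ ε(a))`
(Stub S1 = the bet); hence `‖w‖₂, ‖w‖_∞ ≲ √ε(a)` (energy estimate + the Feulefack–Jarohs–Weth δ-decomposition maximum
principle, the landed `stub_supBound` technique) and, by BOUNDARY REGULARITY of the logarithmic-order operator with bounded
source (Stub S2, the inhomogeneous twin of crux 1039's `stub_edgeLaw`; borderline barrier `(log 1/d)^{-1/2}` + comparison,
Hernández-Santamaría–Ríos–Saldaña arXiv:2401.18033, FJW arXiv:2010.10448), the `L²` EDGE MASS of `u` (`= w` near the edge: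
the block is cut off at distance `d` from it) is SLAVED TO THE BOTTOM: `∫_{a−r<|x|} |u|² ≤ K₁ ε(a) · r/log(1/r)` (Stub S3).
The closing move is the triage-mandated one (r1-2/r1-3 "adopt the collar-cut glue, not the Hadamard identity"): cut the
ground state of the LARGER window `a + h` down to `a` (LANDED `stub_localizedCut` with its landed antecedents
`stub_formDomainPos`, `stub_groundStateEnergy`, `stub_eulerLagrange`), bound the commutator RELATIVELY,
`≤ h (K ε(a+h) + η)` (Stub S4: the landed shell analysis of `stub_commutatorBound` with the edge constant tracked; the
long jumps to the far side and the prime atoms are only `√ε · h/√log(1/h)`, which is why the `η`-slack of the crux is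
exactly what the method delivers and why `η` disappears in the liminf), divide by `‖χu‖² ≥ 1/2` and use antitonicity
`ε(a+h) ≤ ε(a)`: `ε(a) − ε(a+h) ≤ h (2K ε(a) + η)` for every `h ≤ h₀(η/2)`, i.e. `DiniLeakage` with `K(b₀,A) := 2K(b₀,A+1)`.
RIGHT DIFFERENCES (triage G2) are handled by uniformity of S3/S4 over the compact range `[b₀, A+1] ∋ a + h`, not by a
left/right reflection.

## Registered stubs (5; every signature is written over EXISTING declarations only — no local `def`)

* `stub_radicalIdentity`    (S0) Connes's radical identity `W(𝓔f ⋆ w̃) = 0` in the tree's normalisation — size M/L,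
                                 unconditional (the card's First lemma)
* `stub_shadowCore`         (S1) (S0) → the radical block: finite-rank near-radical family + gap, relative to the bottom —
                                 size XL, RH-STRENGTH, THE BET (HARDEST)
* `stub_boundaryLaw`        (S2) inhomogeneous boundary law: bounded weak solutions with bounded source have
                                 `L²` edge mass `≤ C σ² r/log(1/r)` — size L, unconditional linear PDE
* `stub_shadowEdgeMass`     (S3) (S1) → (S2) → relative edge-mass law for ground states — size M/L, unconditional
* `stub_relativeCommutator` (S4) relative edge-mass law → relative commutator bound for admissible cutoffs — size M/L,
                                 unconditional hard analysis
Composition: `diniLeakage_of_stubs : S1′ → S2′ → (S1′ → S2′ → S3′) → (S3η′ → S4′) → <crux unfolded>` is sorry-free (cutoff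
construction, landed (D) with its landed antecedents, antitonicity and the slack bridge proved here), and
`DiniLeakage_of : DiniLeakage` — the ONLY theorem concluding the crux by name — applies it to the five stubs BY NAME
(`stub_shadowCore stub_radicalIdentity`, …).  `sorry` occurs ONLY inside the five `stub_*`.  Calibration (sorry-free):
`shadowCore_of_strictFloor`, `diniLeakage_of_strictFloor` (crux ⟸ ε-floor on ranges + S2′–S4′).

## Honest logical status (triage "common finding" accepted)
`K` is free per compact range, so every RELATIVE statement here (S1(iv), S3′, the crux itself) is, on a range where
`ε > 0`, equivalent to its ABSOLUTE twin with constant `/min ε` (retriage note on the item; r1-1 G3).  The skeleton does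
not pretend otherwise: S2, S3, S4 are unconditional analysis (S2 even subsumes crux 1039's pointwise edge law in `L²`
form: take `s = 0`, `σ = K_sup`), and ALL the RH content sits in S1, whose intended witness is the Gram–Schmidt family of
cut-off radical images of prolates (definition requests `radicalMap 𝓔`, `prolatePSWF`: absent from tree and Mathlib) and
whose two RH-strength conjuncts are (iii) the order-one gap off the block (margin-type) and (iv) "the block residual of
the ground state is `O(√ε(a))`" (a LOWER envelope for `ε` at the prolate-tail scale, no margin; Connes arXiv:2602.04022
§6.6 open step).  The envelope `K ≈ 8πe^{2a}` (Slepian) is information carried by the line card, never needed for the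
crux as typed.

Disproof.lean honoured: `0 < b₀` is USED in S3 (`κ_δ ≥ M_{A} + ε(b₀) + 1` in the δ-trick), in S4 (`ε(a) ≤ ε(b₀)` bounds
the `√ε` lower-order terms; opposite-edge jumps have length `≥ b₀`) and in the glue (`0 < a`); `K = K(b₀, A)` blows up as
`b₀ → 0⁺` (`not_diniLeakageUniformK`) and as `A → ∞`; `η` enters only through `h₀(η)` (`diniLeakage_iff_eta0`); no virial
of any near-minimiser appears (triage r1-1 F1 / r1-3 §1: typed `VirialLeakage` is false) — only TRUE ground states.
Disproof.lean itself READ in its published form (`Cruxes/DiniLeakage/Disproof.lean`, 2026-08-16T04:50Z): it has no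
`-- Targets` stub kills and no sorried near-miss beyond the above.  Landed NEGATIVE lemma checked (scratch import):
`Theorems/WindowLipschitz/Negative/CutDontSqueezeFloors.lean` (`edgeMassLaw_false_without_floor`,
`edgeMassLaw_constant_lower_bound`, `supBound_false_without_floor`) — (S2), (S3′), (S4) keep the floor `0 < b₀` and
per-range constants (S3's `r₀ ≤ d < b₀`), so no stub is an instance of the refuted floor-free shapes.
`ledger negatives --problem RiemannHypothesis`: none (triage r1-1…3, 2026-08-16); no `Theorems/…/DiniLeakage/Negative/` lemma.
-/

set_option linter.dupNamespace false

noncomputable section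

open MeasureTheory Set Filter
open scoped Topology ENNReal NNReal

namespace Summit.RiemannHypothesis.RiemannHypothesis.Cruxes.DiniLeakage.RadicalShadowSlepianEdge

open Literature.NumberTheory.LFunctions
open Summit.RiemannHypothesis.RiemannHypothesis.Theses.WeilWindowFlow (DiniLeakage)

/-! ### The five registered stubs -/

/-- **Stub S0 `stub_radicalIdentity` — Connes's radical identity in the tree's normalisation (size M/L; UNCONDITIONAL; the
card's First lemma `RadicalIdentity`).**  For an EVEN test function `f` (smooth, compact support) with the two Poisson
conditions `f(0) = 0`, `∫ f = 0` (Connes's class `𝒮₀^{ev}` cut to compact support), the additive-variable radical image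
`v(t) := e^{t/2} Σ_{n≥1} f(n e^t)` (Connes's `𝓔(f)(u) = u^{1/2}Σ_{n≥1} f(nu)` at `u = e^t`, arXiv:2106.01715 §3,
arXiv:2602.04022 §6.3) is `Q`-ORTHOGONAL TO EVERY TEST FUNCTION: `W(v ⋆ w̃) = 0`.
Why true: `v̂(s) = weilMellin v s = Σ_n ∫ f(ne^t)e^{st}dt = ζ(s)·Mf(s)` for `Re s > 1` (`Mf(s) = ∫₀^∞ f(y)y^{s−1}dy`,
holomorphic on `Re s > −2` as `f(y) = O(y²)`), the pole at `s = 1` is cancelled by `Mf(1) = ½∫ f = 0`, and `v` is smooth,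
`= 0` for `t ≫ 0` and `O(e^{Nt})` for every `N` as `t → −∞` (Poisson summation for the even Schwartz `f`:
`Σ_{n≥1} f(nu) = (2u)^{-1}f̂(0) − f(0)/2 + u^{-1}Σ_{m≥1} f̂(m/u) = O(u^∞)`), so `k := v ⋆ w̃` is in Weil's class,
every term of `W(k) = weilFunctional k` converges absolutely, and the explicit formula `W(k) = lim_T Σ_{|Im ρ|≤T} k̂(ρ)`
(tree: `explicit_formula_holds` for compact support; here extended to rapidly decaying smooth `k`, or re-run the contour
argument of `WeilExplicitFormulaProofs`) gives `W(k) = Σ_ρ ζ(ρ) Mf(ρ) ŵ̃(ρ) = 0` — at EVERY non-trivial zero, on the line or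
not (the point of the lever: unconditional).  Used by (S1): the E–L residual of a cut-off radical image `χ_a v` against
window tests is `−W(((1−χ_a)v) ⋆ w̃)`, the potential of a prolate TAIL.
Sources: Connes–Consani arXiv:2106.01715 §3 (p.11: `Q(𝓔f, w) = 0`), Connes arXiv:2602.04022 §6.3 Facts 6.3–6.4; tree
`explicit_formula_holds`, `weilMellin_weilConv`, `weilMellin_comp_mul`.  Why it might fail: it does not (it is the explicit
formula); the Lean size is the extension of `W`'s bookkeeping from compact support to the rapidly decaying class. -/
theorem stub_radicalIdentity :
    ∀ f w : ℝ → ℂ, IsWeilTest f → (∀ x : ℝ, f (-x) = f x) → f 0 = 0 → (∫ x, f x = 0) →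
      IsWeilTest w →
        weilFunctional (weilConv (fun t : ℝ ↦ (Real.exp (t / 2) : ℂ) *
          ∑' n : ℕ, f (((n + 1 : ℕ) : ℝ) * Real.exp t)) (weilReflect w)) = 0 := by
  sorry

/-- **Stub S1 `stub_shadowCore` — the radical block (RH-STRENGTH; THE BET; size XL, HARDEST).**
On every compact window range `[b₀, A]` there are a level `c > 0`, a size `κ`, a collar width `d > 0` and a rank `N`
such that every window `a ∈ [b₀, A]` carries an `L²`-orthonormal family `F₁ … F_N` of TEST functions supported in
`[−(a−d), a−d]` (cut off before the edge), bounded by `κ`, with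
(iii) GAP: `Re Q(g) ≥ c‖g‖²` for every window-`a` test function `g ⊥ F` (coercivity of order one off the block), and
(iv) NEAR-RADICALITY RELATIVE TO THE BOTTOM: for every ground state `u` of the window `a`, the weak Euler–Lagrange
RESIDUAL of its block component `f_u := Σ_i ⟨F_i, u⟩ F_i` — the landed E–L left-hand side (pole form + prime and
archimedean increments − `M_a⟨·,·⟩`, exactly as in `…Theorems.WeilWindowFlowWindowLipschitz.stub_eulerLagrange`) minus
`ε(a)⟨f_u, ·⟩` — is represented by a measurable function `s` with `|s|² ≤ κ ε(a)` pointwise.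
Intended witness (the idea): `F` = Gram–Schmidt of `χ_a · (𝓔φ_i ∘ exp)·e^{t/2}`, `φ_i` the prolates of bandwidth
`2πe^{2a}` up to just past the plunge (`N ≈ 2e^{2A} + O(A)`), `χ_a` a smooth cutoff at distance `d` from the edge:
`Q(𝓔φ, ·) ≡ 0` (radical identity, unconditional: `(𝓔φ)^(ρ) = ζ(ρ)φ̃(ρ)`; the card's `RadicalIdentity`), so the residual of
a block vector is the potential of the discarded piece `(1 − χ_a)𝓔φ_i`, a prolate TAIL; (iii) is the card's
`GapBeyondRadical` (= twin card's (i) `CoerciveModProlate`), RH-strength WITH an `O(1)` margin; (iv) says the ground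
state's block component has tail-scale residual `≲ √ε(a)` — by Slepian/Fuchs (`edge value² ≈ c(1 − λ_n)`,
`ε ≈ poly(c)(1 − λ)`, Connes's `1 − χ₂` law) this is a LOWER envelope for `ε(a)` at the prolate-tail scale: RH-strength,
NO margin (Connes arXiv:2602.04022 §6.6; twin card's `SmallCoupling`).  The components of `u` along plunge-zone block
vectors must themselves be `O(√ε)` (coupling/gap inside the block) — this is why (iv) is stated for `f_u`, not for each `F_i`.
Consequences worth knowing: (iv) forces `ε(a) ≥ 0` on the range (Weil positivity there) — unavoidable, the crux implies RH;
with `N = 0` the statement is `ε ≥ c` on the range (true for small windows by `weilQuadratic_coercive`, the easy regime).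
Sources: arXiv:2106.01715 §2.5 p.10 (≈ 2μ−1 small eigenvalues), §3 Def. 3.1, p.12 (eigenvectors ≈ `𝓔(φ_n)`);
arXiv:2602.04022 §§6.3–6.6; Slepian 1964 / Fuchs 1964 (J. Math. Anal. Appl. 9) / Hogan–Lakey §2.6; kit j005797.
Why it might fail: it is RH-strength ((iii) ∧ (iv) ⟹ crux ⟹ RH); as mathematics it fails if a minuscule direction of the
window form is NOT in the radical shadow (twin card falsifier F1: bottom of `QW_λ` on `Range(Π)^⊥` at `μ ∈ {5,…,11}`), or if
`ε(a)` is anomalously small against the prolate-tail scale (F2/F3). -/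
theorem stub_shadowCore :
    (∀ f w : ℝ → ℂ, IsWeilTest f → (∀ x : ℝ, f (-x) = f x) → f 0 = 0 → (∫ x, f x = 0) →
      IsWeilTest w →
        weilFunctional (weilConv (fun t : ℝ ↦ (Real.exp (t / 2) : ℂ) *
          ∑' n : ℕ, f (((n + 1 : ℕ) : ℝ) * Real.exp t)) (weilReflect w)) = 0) →
    ∀ b₀ A : ℝ, 0 < b₀ → b₀ ≤ A → ∃ c κ d : ℝ, 0 < c ∧ 0 ≤ κ ∧ 0 < d ∧
      ∀ a : ℝ, b₀ ≤ a → a ≤ A → ∃ (N : ℕ) (F : Fin N → ℝ → ℂ),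
        (∀ i, IsWeilTest (F i) ∧ tsupport (F i) ⊆ Icc (-(a - d)) (a - d) ∧ ∀ x, ‖F i x‖ ≤ κ) ∧
        (∀ i j, ∫ x, (starRingEnd ℂ) (F i x) * F j x = if i = j then 1 else 0) ∧
        (∀ g : ℝ → ℂ, IsWeilTest g → tsupport g ⊆ Icc (-a) a →
          (∀ i, ∫ x, (starRingEnd ℂ) (F i x) * g x = 0) → c * ∫ x, ‖g x‖ ^ 2 ≤ (weilQuadratic g).re) ∧
        (∀ u : ℝ → ℂ, IsWeilGroundState a u → ∃ s : ℝ → ℂ, Measurable s ∧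
          (∀ x, ‖s x‖ ^ 2 ≤ κ * weilGroundEnergy a) ∧
          ∀ w : ℝ → ℂ, MemLp w 2 → (∀ᵐ x : ℝ, x ∉ Icc (-a) a → w x = 0) →
              IntegrableOn (fun t ↦ weilArchDensity t * weilIncrement w t) (Ioi 0) →
            2 * (∫ x, (∑ i, (∫ y, (starRingEnd ℂ) (F i y) * u y) * F i x) * (Real.cosh (x / 2) : ℂ)) *
                (starRingEnd ℂ) (∫ x, w x * (Real.cosh (x / 2) : ℂ))
              - 2 * (∫ x, (∑ i, (∫ y, (starRingEnd ℂ) (F i y) * u y) * F i x) * (Real.sinh (x / 2) : ℂ)) *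
                (starRingEnd ℂ) (∫ x, w x * (Real.sinh (x / 2) : ℂ))
              + (∑ n ∈ weilPrimeIndex a, (((ArithmeticFunction.vonMangoldt n : ℝ) / Real.sqrt n : ℝ) : ℂ) *
                  ∫ x, ((∑ i, (∫ y, (starRingEnd ℂ) (F i y) * u y) * F i (x + Real.log n)) -
                        (∑ i, (∫ y, (starRingEnd ℂ) (F i y) * u y) * F i x)) *
                    (starRingEnd ℂ) (w (x + Real.log n) - w x))
              + (∫ t in Ioi (0 : ℝ), (weilArchDensity t : ℂ) *
                  ∫ x, ((∑ i, (∫ y, (starRingEnd ℂ) (F i y) * u y) * F i (x + t)) -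
                        (∑ i, (∫ y, (starRingEnd ℂ) (F i y) * u y) * F i x)) *
                    (starRingEnd ℂ) (w (x + t) - w x))
              - (weilMarkovConstant a : ℂ) *
                  ∫ x, (∑ i, (∫ y, (starRingEnd ℂ) (F i y) * u y) * F i x) * (starRingEnd ℂ) (w x)
            = (weilGroundEnergy a : ℂ) *
                (∫ x, (∑ i, (∫ y, (starRingEnd ℂ) (F i y) * u y) * F i x) * (starRingEnd ℂ) (w x))
              + ∫ x, s x * (starRingEnd ℂ) (w x)) := by
  sorry

/-- **Stub S2 `stub_boundaryLaw` — boundary law for the inhomogeneous Euler–Lagrange equation (size L; UNCONDITIONAL,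
linear).**  On a compact window range, let `w ∈ L²` vanish off `[−a, a]`, have finite archimedean energy, be BOUNDED by `σ`,
and solve the weak equation `B_a(w, φ) − M_a⟨w, φ⟩ = λ⟨w, φ⟩ + ⟨s, φ⟩` against every admissible `φ` (same left-hand side as
the landed `stub_eulerLagrange`), with a bounded coefficient `|λ| ≤ Λ₀` and a measurable source `|s| ≤ σ`.  Then the `L²`
edge mass obeys the logarithmic law `∫_{a−r<|x|} |w|² ≤ C σ² · r / log(1/r)` for `0 < r ≤ r₀`, with `C, r₀` depending only on
`b₀, A, Λ₀` (homogeneous of degree two in `(w, s, σ)`).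
Proof route = the borderline-barrier comparison of crux 1039 (lines `borderline-barrier` / `cut-dont-squeeze` Stub P,
architecture of Hernández-Santamaría–Ríos–Saldaña arXiv:2401.18033 Thm 2.4 and Feulefack–Jarohs–Weth arXiv:2010.10448 §3),
run for the LINEAR equation: with `W(d) = (log(1/min(d, d₀)))^{-1/2}`, `B(x) = W(a − |x|)`, the δ-localised archimedean
operator has surplus `≥ ½√(log 1/d₀) − C(δ)` on the layer; test the equation with `(Re e^{-iθ}w − K₁B)₊`,
`K₁ := C'σ√(log 1/d₀)` (`≥ σ ≥ |w|` on the plateau), absorb the source `|⟨s, ·⟩| ≤ σ∫(·)`, the far jumps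
`κ_δ⟨w,·⟩ − ⟨ρ1_{>δ} ⋆ w, ·⟩` (`‖ρ1_{>δ} ⋆ w‖_∞ ≤ C_δ σ`), the pole vector (`≤ C_P σ`) and the prime atoms (`≥ −2S_Aβ₀K₁`)
into the surplus by the Markov inequality: `|w|² log(1/(a−|x|)) ≤ C σ²` a.e. on the layer, then integrate over
`{a − r < |x| ≤ a}` (measure `2r`; the sorry-free bridge `edgeMassLaw_of_pointwise` of line `cut-dont-squeeze`).
With `s = 0`, `λ = ε(a)`, `σ = K_sup` (landed `stub_supBound`) this IS crux 1039's edge law in `L²` form — one engine serves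
both cruxes.  Sources: arXiv:2401.18033 Thms 1.1–1.4, 2.4 (exponent ½ sharp, two-sided); arXiv:2010.10448 Thm 1.1, §3;
Chen–Weth arXiv:1710.03416.  Why it might fail: it does not in substance for bounded sources (the `½`-law is the linear
theory's); the Lean size is the surplus-constant bookkeeping (shared with 1039's `stub_edgeLaw`, whose helpers
`…StubBarrierEnergy`, `…StubSurplus*Aux`, `…StubComparisonAux` are landing). -/
theorem stub_boundaryLaw :
    ∀ b₀ A Λ₀ : ℝ, 0 < b₀ → b₀ ≤ A → ∃ C r₀ : ℝ, 0 ≤ C ∧ 0 < r₀ ∧ r₀ < 1 ∧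
      ∀ (a lam σ : ℝ) (w s : ℝ → ℂ), b₀ ≤ a → a ≤ A → |lam| ≤ Λ₀ → 0 ≤ σ →
        MemLp w 2 → (∀ᵐ x : ℝ, x ∉ Icc (-a) a → w x = 0) →
        IntegrableOn (fun t ↦ weilArchDensity t * weilIncrement w t) (Ioi 0) →
        (∀ᵐ x : ℝ, ‖w x‖ ≤ σ) → Measurable s → (∀ x, ‖s x‖ ≤ σ) →
        (∀ φ : ℝ → ℂ, MemLp φ 2 → (∀ᵐ x : ℝ, x ∉ Icc (-a) a → φ x = 0) →
            IntegrableOn (fun t ↦ weilArchDensity t * weilIncrement φ t) (Ioi 0) →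
          2 * (∫ x, w x * (Real.cosh (x / 2) : ℂ)) * (starRingEnd ℂ) (∫ x, φ x * (Real.cosh (x / 2) : ℂ))
            - 2 * (∫ x, w x * (Real.sinh (x / 2) : ℂ)) * (starRingEnd ℂ) (∫ x, φ x * (Real.sinh (x / 2) : ℂ))
            + (∑ n ∈ weilPrimeIndex a, (((ArithmeticFunction.vonMangoldt n : ℝ) / Real.sqrt n : ℝ) : ℂ) *
                ∫ x, (w (x + Real.log n) - w x) * (starRingEnd ℂ) (φ (x + Real.log n) - φ x))
            + (∫ t in Ioi (0 : ℝ), (weilArchDensity t : ℂ) *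
                ∫ x, (w (x + t) - w x) * (starRingEnd ℂ) (φ (x + t) - φ x))
            - (weilMarkovConstant a : ℂ) * ∫ x, w x * (starRingEnd ℂ) (φ x)
          = (lam : ℂ) * (∫ x, w x * (starRingEnd ℂ) (φ x)) + ∫ x, s x * (starRingEnd ℂ) (φ x)) →
        ∀ r : ℝ, 0 < r → r ≤ r₀ →
          ∫ x in {x : ℝ | a - r < |x|}, ‖w x‖ ^ 2 ≤ C * σ ^ 2 * r / Real.log (1 / r) := by
  sorry

/-- **Stub S3 `stub_shadowEdgeMass` — the shadow argument: (S1) → (S2) → relative `L²` edge-mass law for ground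
states (size M/L; UNCONDITIONAL given its two antecedents).**  Conclusion: on `[b₀, A]` there are `K ≥ 0`, `r₀ ∈ (0,1)` with
`∫_{a−r<|x|} |u|² ≤ K ε(a) · r/log(1/r)` for every ground state `u` of every window `a ∈ [b₀, A]` and `0 < r ≤ r₀`.
Proof route.  Fix the data `c, κ, d, N` of (S1) on `[b₀, A]` and `K_sup` (LANDED `stub_supBound` with its landed
antecedents `stub_groundStateEnergy`, `stub_eulerLagrange stub_formDomainPos stub_groundStateEnergy`).
EASY REGIME `ε(a) ≥ c/2`: (S2) for `u` itself (`λ = ε(a)`, `s = 0`, `σ = K_sup`; the equation is the landed E–L identity)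
gives the ABSOLUTE law `≤ C K_sup² r/log(1/r) ≤ (2CK_sup²/c) ε(a) r/log(1/r)`.
GAP REGIME `ε(a) < c/2`: let `F` be the family of (S1) at `a`, `f := Σ⟨F_i,u⟩F_i` (a test function, `|⟨F_i,u⟩| ≤ 1`),
`w := u − f`; then `w ⊥ F` (orthonormality), `w` is admissible (finite energy: landed (C2) for `u`, `f` smooth), and
subtracting (S1)(iv) from the landed E–L identity (sesquilinearity of the explicit left-hand side in its first slot)
`B_a(w, φ) − M_a⟨w,φ⟩ = ε(a)⟨w,φ⟩ − ⟨s, φ⟩` for all admissible `φ`.  (1) ENERGY: `φ = w` and the gap extended from tests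
`⊥ F` to admissible `w ⊥ F` (density from inside as in landed (C1): shrink, mollify, re-orthogonalise by the
`L²`-continuous finite-rank projection) give `(c − ε(a))‖w‖₂² ≤ |⟨s,w⟩| ≤ √(κε(a))·√(2a)‖w‖₂`, so `‖w‖₂ ≤ 2√(2Aκ ε(a))/c`.
(2) SUP: the Feulefack–Jarohs–Weth δ-decomposition maximum principle for the LINEAR equation of `w` (template: the landed
proof of `stub_supBound`; far jumps `κ_δ⟨w,·⟩ − ⟨ρ1_{>δ}⋆w,·⟩` with `‖ρ1_{>δ}⋆w‖_∞ ≤ (2∫_δ^∞ρ²)^{1/2}‖w‖₂`, pole vector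
`≤ C_P‖w‖₂`, source `≤ √(κε)`, `κ_δ ≥ M_A + ε(b₀) + 1` — the floor `0 < b₀`) gives `‖w‖_∞ ≤ C″√ε(a)` a.e.
(3) EDGE: (S2) with `σ := max(C″, 1)·√(κ' ε(a))`, `λ = ε(a)` (`|ε(a)| ≤ max(|ε(b₀)|, |ε(A)|) =: Λ₀`, antitonicity) bounds the
collar mass of `w`; and `u = w` on `{a − r < |x|}` for `r ≤ d` because every `F_i` vanishes on `|x| > a − d`.  At a window
with `ε(a) = 0` step (1) gives `w = 0`, consistent.  Take `K := max` of the two regimes, `r₀ := min(r₀(S2), d)`.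
Sources: twin card `coercive-mod-prolate-block` (Schur complement heuristics `‖w‖ ~ coupling/gap`); triage r1-2 sharpen
("reducible to boundary regularity of the complement … log-Laplacian theory WITH margin"); arXiv:2010.10448 §3.
Why it might fail: it does not in substance once (S1), (S2) hold (linear functional analysis + a maximum principle);
the Lean size is the sesquilinear bookkeeping of the explicit form and the density step for the gap. -/
theorem stub_shadowEdgeMass :
    (∀ b₀ A : ℝ, 0 < b₀ → b₀ ≤ A → ∃ c κ d : ℝ, 0 < c ∧ 0 ≤ κ ∧ 0 < d ∧
      ∀ a : ℝ, b₀ ≤ a → a ≤ A → ∃ (N : ℕ) (F : Fin N → ℝ → ℂ),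
        (∀ i, IsWeilTest (F i) ∧ tsupport (F i) ⊆ Icc (-(a - d)) (a - d) ∧ ∀ x, ‖F i x‖ ≤ κ) ∧
        (∀ i j, ∫ x, (starRingEnd ℂ) (F i x) * F j x = if i = j then 1 else 0) ∧
        (∀ g : ℝ → ℂ, IsWeilTest g → tsupport g ⊆ Icc (-a) a →
          (∀ i, ∫ x, (starRingEnd ℂ) (F i x) * g x = 0) → c * ∫ x, ‖g x‖ ^ 2 ≤ (weilQuadratic g).re) ∧
        (∀ u : ℝ → ℂ, IsWeilGroundState a u → ∃ s : ℝ → ℂ, Measurable s ∧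
          (∀ x, ‖s x‖ ^ 2 ≤ κ * weilGroundEnergy a) ∧
          ∀ w : ℝ → ℂ, MemLp w 2 → (∀ᵐ x : ℝ, x ∉ Icc (-a) a → w x = 0) →
              IntegrableOn (fun t ↦ weilArchDensity t * weilIncrement w t) (Ioi 0) →
            2 * (∫ x, (∑ i, (∫ y, (starRingEnd ℂ) (F i y) * u y) * F i x) * (Real.cosh (x / 2) : ℂ)) *
                (starRingEnd ℂ) (∫ x, w x * (Real.cosh (x / 2) : ℂ))
              - 2 * (∫ x, (∑ i, (∫ y, (starRingEnd ℂ) (F i y) * u y) * F i x) * (Real.sinh (x / 2) : ℂ)) *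
                (starRingEnd ℂ) (∫ x, w x * (Real.sinh (x / 2) : ℂ))
              + (∑ n ∈ weilPrimeIndex a, (((ArithmeticFunction.vonMangoldt n : ℝ) / Real.sqrt n : ℝ) : ℂ) *
                  ∫ x, ((∑ i, (∫ y, (starRingEnd ℂ) (F i y) * u y) * F i (x + Real.log n)) -
                        (∑ i, (∫ y, (starRingEnd ℂ) (F i y) * u y) * F i x)) *
                    (starRingEnd ℂ) (w (x + Real.log n) - w x))
              + (∫ t in Ioi (0 : ℝ), (weilArchDensity t : ℂ) *
                  ∫ x, ((∑ i, (∫ y, (starRingEnd ℂ) (F i y) * u y) * F i (x + t)) -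
                        (∑ i, (∫ y, (starRingEnd ℂ) (F i y) * u y) * F i x)) *
                    (starRingEnd ℂ) (w (x + t) - w x))
              - (weilMarkovConstant a : ℂ) *
                  ∫ x, (∑ i, (∫ y, (starRingEnd ℂ) (F i y) * u y) * F i x) * (starRingEnd ℂ) (w x)
            = (weilGroundEnergy a : ℂ) *
                (∫ x, (∑ i, (∫ y, (starRingEnd ℂ) (F i y) * u y) * F i x) * (starRingEnd ℂ) (w x))
              + ∫ x, s x * (starRingEnd ℂ) (w x))) →
    (∀ b₀ A Λ₀ : ℝ, 0 < b₀ → b₀ ≤ A → ∃ C r₀ : ℝ, 0 ≤ C ∧ 0 < r₀ ∧ r₀ < 1 ∧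
      ∀ (a lam σ : ℝ) (w s : ℝ → ℂ), b₀ ≤ a → a ≤ A → |lam| ≤ Λ₀ → 0 ≤ σ →
        MemLp w 2 → (∀ᵐ x : ℝ, x ∉ Icc (-a) a → w x = 0) →
        IntegrableOn (fun t ↦ weilArchDensity t * weilIncrement w t) (Ioi 0) →
        (∀ᵐ x : ℝ, ‖w x‖ ≤ σ) → Measurable s → (∀ x, ‖s x‖ ≤ σ) →
        (∀ φ : ℝ → ℂ, MemLp φ 2 → (∀ᵐ x : ℝ, x ∉ Icc (-a) a → φ x = 0) →
            IntegrableOn (fun t ↦ weilArchDensity t * weilIncrement φ t) (Ioi 0) →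
          2 * (∫ x, w x * (Real.cosh (x / 2) : ℂ)) * (starRingEnd ℂ) (∫ x, φ x * (Real.cosh (x / 2) : ℂ))
            - 2 * (∫ x, w x * (Real.sinh (x / 2) : ℂ)) * (starRingEnd ℂ) (∫ x, φ x * (Real.sinh (x / 2) : ℂ))
            + (∑ n ∈ weilPrimeIndex a, (((ArithmeticFunction.vonMangoldt n : ℝ) / Real.sqrt n : ℝ) : ℂ) *
                ∫ x, (w (x + Real.log n) - w x) * (starRingEnd ℂ) (φ (x + Real.log n) - φ x))
            + (∫ t in Ioi (0 : ℝ), (weilArchDensity t : ℂ) *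
                ∫ x, (w (x + t) - w x) * (starRingEnd ℂ) (φ (x + t) - φ x))
            - (weilMarkovConstant a : ℂ) * ∫ x, w x * (starRingEnd ℂ) (φ x)
          = (lam : ℂ) * (∫ x, w x * (starRingEnd ℂ) (φ x)) + ∫ x, s x * (starRingEnd ℂ) (φ x)) →
        ∀ r : ℝ, 0 < r → r ≤ r₀ →
          ∫ x in {x : ℝ | a - r < |x|}, ‖w x‖ ^ 2 ≤ C * σ ^ 2 * r / Real.log (1 / r)) →
    ∀ b₀ A : ℝ, 0 < b₀ → b₀ ≤ A → ∃ K r₀ : ℝ, 0 ≤ K ∧ 0 < r₀ ∧ r₀ < 1 ∧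
      ∀ (a r : ℝ) (u : ℝ → ℂ), b₀ ≤ a → a ≤ A → IsWeilGroundState a u → 0 < r → r ≤ r₀ →
        ∫ x in {x : ℝ | a - r < |x|}, ‖u x‖ ^ 2 ≤ K * weilGroundEnergy a * r / Real.log (1 / r) := by
  sorry

/-- **Stub S4 `stub_relativeCommutator` — the relative commutator bound (size M/L; UNCONDITIONAL hard analysis).**
SIGNATURE IDENTICAL to line `collar-cut-edge-mass`'s `CollarCutEdgeMass.stub_relCommutatorBound` (the triage-mandated
closing move is common to all lines of this crux: ONE proof serves both skeletons).  Its hypothesis is the relative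
edge-mass law WITH slack `(K ε(a) + η) r/log(1/r)`, which (S3′) implies trivially (`relEdgeMassEta_of` below, sorry-free).
From that law: on `[b₀, A]` there is `K ≥ 0` and, for every `η > 0`, a width `h₀ > 0` such that for
every window `a ∈ [b₀, A]`, width `0 < h ≤ h₀`, ground state `u` of the window `a` and ADMISSIBLE CUTOFF `χ` (values in
`[0,1]`, `= 1` on `|x| ≤ a − 2h`, `= 0` on `|x| ≥ a − h`, slope `≤ 1/h`) the right-hand side of the landed localised-cut
inequality (`…Theorems.WeilWindowFlowWindowLipschitz.stub_localizedCut`) is `≤ h (K ε(a) + η)` and `‖χu‖² ≥ 1/2`.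
Proof route = the landed shell analysis of `stub_commutatorBound` (Theorems `…StubCommutatorBound`, `…Aux1–4`) with the
edge constant TRACKED: write `m(r) := ∫_{a−r<|x|}|u|² ≤ K₁ε(a) r/log(1/r)` (S3′) and `‖u‖_∞ ≤ K_sup` (landed
`stub_supBound`).  MAIN TERMS: (I) partner within `4h` of the same edge — Schur test with `∫₀^{4h}min(1,t²/h²)ρ ≤ ½ + log 4`:
`≤ 2m(4h) ≤ C_abs K₁ε(a) h`; (II) layer point against the same-side bulk in dyadic shells, Cauchy–Schwarz SHELL BY SHELL:
`∫_L|u| · sup_L Π ≤ [h(K₁ε/log(1/h))^{1/2}]·[(K₁ε log(1/h))^{1/2} C_abs + ρ(d₀/2)‖u‖₁] = C_abs K₁ε(a) h + O(h√(K₁ε/log(1/h)))`.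
LOWER-ORDER TERMS are `√ε`-small, not `ε`-small — (III) jumps to the opposite side (`|x−y| ≥ a − 2h ≥ b₀/2`), the prime
atoms (partner at distance `log n`, bounded by `K_sup`) and the polar remainders are all `≤ C(b₀,A) · h · √(K₁ε(a)/log(1/h))`
with `ε(a) ≤ ε(b₀)` — so they are `≤ η h` once `log(1/h) ≥ C² K₁ ε(b₀)/η²`: this is where the crux's `η` is spent and why
`h₀` depends on `η` (and on `b₀`, the floor).  Mass: `‖χu‖² ≥ 1 − m(2h) ≥ 1/2`.  (If `ε(a) < 0` the hypothesis is
contradictory since `m ≥ 0`, and the clause holds vacuously.)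
Sources: line `cut-dont-squeeze` Stub E (hand-checked by triage ×3 for crux 1039) and its landed proof; kit j005651
(cut-cost/h flat over six decades).  Why it might fail: it does not given (S3′); the only new point over the landed
absolute bound is that the two MAIN terms are linear in the edge constant while the rest is `o(h)` uniformly. -/
theorem stub_relativeCommutator :
    (∀ b₀ A : ℝ, 0 < b₀ → b₀ ≤ A → ∃ K : ℝ, 0 ≤ K ∧ ∀ η : ℝ, 0 < η → ∃ r₀ : ℝ, 0 < r₀ ∧ r₀ < 1 ∧
      ∀ (a r : ℝ) (u : ℝ → ℂ), b₀ ≤ a → a ≤ A → IsWeilGroundState a u → 0 < r → r ≤ r₀ →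
        ∫ x in {x : ℝ | a - r < |x|}, ‖u x‖ ^ 2 ≤
          (K * weilGroundEnergy a + η) * r / Real.log (1 / r)) →
    ∀ b₀ A : ℝ, 0 < b₀ → b₀ ≤ A → ∃ K : ℝ, 0 ≤ K ∧ ∀ η : ℝ, 0 < η → ∃ h₀ : ℝ, 0 < h₀ ∧
        ∀ (a h : ℝ) (u : ℝ → ℂ) (χ : ℝ → ℝ), b₀ ≤ a → a ≤ A → 0 < h → h ≤ h₀ →
        IsWeilGroundState a u → (∀ x y, |χ x - χ y| ≤ |x - y| / h) → (∀ x, 0 ≤ χ x ∧ χ x ≤ 1) →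
        (∀ x, |x| ≤ a - 2 * h → χ x = 1) → (∀ x, a - h ≤ |x| → χ x = 0) →
        (∫ t in Ioi (0 : ℝ), weilArchDensity t *
              ∫ x, (χ (x + t) - χ x) ^ 2 * (‖u (x + t)‖ * ‖u x‖)) +
          (∑ n ∈ weilPrimeIndex a, (ArithmeticFunction.vonMangoldt n : ℝ) / Real.sqrt n *
              ∫ x, (χ (x + Real.log n) - χ x) ^ 2 * (‖u (x + Real.log n)‖ * ‖u x‖)) +
          2 * ‖∫ t, ((1 - χ t : ℝ) : ℂ) * u t * (Real.cosh (t / 2) : ℂ)‖ ^ 2 +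
          2 * ‖∫ t, u t * (Real.cosh (t / 2) : ℂ)‖ *
              ‖∫ t, (((1 - χ t) ^ 2 : ℝ) : ℂ) * u t * (Real.cosh (t / 2) : ℂ)‖ +
          2 * ‖∫ t, u t * (Real.sinh (t / 2) : ℂ)‖ *
              ‖∫ t, (((1 - χ t) ^ 2 : ℝ) : ℂ) * u t * (Real.sinh (t / 2) : ℂ)‖ ≤
            h * (K * weilGroundEnergy a + η) ∧
          1 / 2 ≤ ∫ x, ‖(χ x : ℂ) * u x‖ ^ 2 := by
  sorry

/-! ### Sorry-free glue -/

/-- Antitonicity of the window bottom: a larger window has a smaller bottom (`sInf` over a larger, still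
bounded-below set; the smaller sphere is nonempty).  Proved here so that the composition is sorry-free (the
disprover's `eps_antitoneOn` and line `cut-dont-squeeze`'s `weilGroundEnergy_antitone` are the same statement). -/
theorem eps_antitone {a b : ℝ} (hb : 0 < b) (hba : b ≤ a) :
    weilGroundEnergy a ≤ weilGroundEnergy b := by
  obtain ⟨g, hg, hs, hn⟩ := exists_isWeilTest_sphere hb
  refine le_csInf ⟨_, g, hg, hs, hn, rfl⟩ ?_
  rintro x ⟨h, hh, hhs, hhn, rfl⟩
  exact csInf_le (bddBelow_weilQuadratic_sphere_holds a)
    ⟨h, hh, hhs.trans (Icc_subset_Icc (neg_le_neg hba) hba), hhn, rfl⟩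


/-- **Slack is free** (sorry-free bridge): the relative edge-mass law WITHOUT slack (S3′) implies the form WITH slack
`(K ε(a) + η) · r/log(1/r)` that the shared commutator stub (S4) consumes (`η r/log(1/r) ≥ 0` for `0 < r < 1`). -/
theorem relEdgeMassEta_of
    (hB : ∀ b₀ A : ℝ, 0 < b₀ → b₀ ≤ A → ∃ K r₀ : ℝ, 0 ≤ K ∧ 0 < r₀ ∧ r₀ < 1 ∧
      ∀ (a r : ℝ) (u : ℝ → ℂ), b₀ ≤ a → a ≤ A → IsWeilGroundState a u → 0 < r → r ≤ r₀ →
        ∫ x in {x : ℝ | a - r < |x|}, ‖u x‖ ^ 2 ≤ K * weilGroundEnergy a * r / Real.log (1 / r)) :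
    ∀ b₀ A : ℝ, 0 < b₀ → b₀ ≤ A → ∃ K : ℝ, 0 ≤ K ∧ ∀ η : ℝ, 0 < η → ∃ r₀ : ℝ, 0 < r₀ ∧ r₀ < 1 ∧
      ∀ (a r : ℝ) (u : ℝ → ℂ), b₀ ≤ a → a ≤ A → IsWeilGroundState a u → 0 < r → r ≤ r₀ →
        ∫ x in {x : ℝ | a - r < |x|}, ‖u x‖ ^ 2 ≤
          (K * weilGroundEnergy a + η) * r / Real.log (1 / r) := by
  intro b₀ A hb₀ hb₀A
  obtain ⟨K, r₀, hK, hr₀, hr₀1, hKB⟩ := hB b₀ A hb₀ hb₀A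
  refine ⟨K, hK, fun η hη ↦ ⟨r₀, hr₀, hr₀1, ?_⟩⟩
  intro a r u ha haA hu hr hrr
  have hlog : 0 < Real.log (1 / r) := by
    apply Real.log_pos
    rw [lt_div_iff₀ hr, one_mul]
    exact lt_of_le_of_lt hrr hr₀1
  calc ∫ x in {x : ℝ | a - r < |x|}, ‖u x‖ ^ 2
      ≤ K * weilGroundEnergy a * r / Real.log (1 / r) := hKB a r u ha haA hu hr hrr
    _ ≤ (K * weilGroundEnergy a + η) * r / Real.log (1 / r) := by
        apply div_le_div_of_nonneg_right _ hlog.le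
        nlinarith [hη, hr]

/-! ### Calibration: the empty block (sorry-free) -/

/-- **Calibration (sorry-free): a positive floor for `ε` on compact ranges already implies (S1′)** — with the EMPTY
block (`N = 0`, `c :=` the floor, `κ := 0`, `d := 1`, `s := 0`; the gap is `weilGroundEnergy_mul_le_re`, the residual
identity collapses to `0 = 0`).  Hence, AS TYPED, (S1′) ⟸ "`inf_{[b₀,A]} ε > 0` on every range" (⟸ RH ∧ `StrictUnderRH`,
item 1043, by the proved continuity of `ε`), and `DiniLeakage_of_strictFloor` below reduces the crux to that floor plus
the UNCONDITIONAL stubs (S2)–(S4): the radical block of (S0)/(S1) is the line's proposed ROUTE into the floor-free regime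
(an order-one gap modulo an explicit finite rank where `ε ~ e^{-4πe^{2a}}`), not extra logical strength — the triage's
"common finding", recorded here as a theorem rather than a remark (cf. cdisprove `diniLeakage_iff_riemannHypothesis`). -/
theorem shadowCore_of_strictFloor
    (hfloor : ∀ b₀ A : ℝ, 0 < b₀ → b₀ ≤ A → ∃ c : ℝ, 0 < c ∧
      ∀ a : ℝ, b₀ ≤ a → a ≤ A → c ≤ weilGroundEnergy a) :
    ∀ b₀ A : ℝ, 0 < b₀ → b₀ ≤ A → ∃ c κ d : ℝ, 0 < c ∧ 0 ≤ κ ∧ 0 < d ∧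
      ∀ a : ℝ, b₀ ≤ a → a ≤ A → ∃ (N : ℕ) (F : Fin N → ℝ → ℂ),
        (∀ i, IsWeilTest (F i) ∧ tsupport (F i) ⊆ Icc (-(a - d)) (a - d) ∧ ∀ x, ‖F i x‖ ≤ κ) ∧
        (∀ i j, ∫ x, (starRingEnd ℂ) (F i x) * F j x = if i = j then 1 else 0) ∧
        (∀ g : ℝ → ℂ, IsWeilTest g → tsupport g ⊆ Icc (-a) a →
          (∀ i, ∫ x, (starRingEnd ℂ) (F i x) * g x = 0) → c * ∫ x, ‖g x‖ ^ 2 ≤ (weilQuadratic g).re) ∧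
        (∀ u : ℝ → ℂ, IsWeilGroundState a u → ∃ s : ℝ → ℂ, Measurable s ∧
          (∀ x, ‖s x‖ ^ 2 ≤ κ * weilGroundEnergy a) ∧
          ∀ w : ℝ → ℂ, MemLp w 2 → (∀ᵐ x : ℝ, x ∉ Icc (-a) a → w x = 0) →
              IntegrableOn (fun t ↦ weilArchDensity t * weilIncrement w t) (Ioi 0) →
            2 * (∫ x, (∑ i, (∫ y, (starRingEnd ℂ) (F i y) * u y) * F i x) * (Real.cosh (x / 2) : ℂ)) *
                (starRingEnd ℂ) (∫ x, w x * (Real.cosh (x / 2) : ℂ))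
              - 2 * (∫ x, (∑ i, (∫ y, (starRingEnd ℂ) (F i y) * u y) * F i x) * (Real.sinh (x / 2) : ℂ)) *
                (starRingEnd ℂ) (∫ x, w x * (Real.sinh (x / 2) : ℂ))
              + (∑ n ∈ weilPrimeIndex a, (((ArithmeticFunction.vonMangoldt n : ℝ) / Real.sqrt n : ℝ) : ℂ) *
                  ∫ x, ((∑ i, (∫ y, (starRingEnd ℂ) (F i y) * u y) * F i (x + Real.log n)) -
                        (∑ i, (∫ y, (starRingEnd ℂ) (F i y) * u y) * F i x)) *
                    (starRingEnd ℂ) (w (x + Real.log n) - w x))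
              + (∫ t in Ioi (0 : ℝ), (weilArchDensity t : ℂ) *
                  ∫ x, ((∑ i, (∫ y, (starRingEnd ℂ) (F i y) * u y) * F i (x + t)) -
                        (∑ i, (∫ y, (starRingEnd ℂ) (F i y) * u y) * F i x)) *
                    (starRingEnd ℂ) (w (x + t) - w x))
              - (weilMarkovConstant a : ℂ) *
                  ∫ x, (∑ i, (∫ y, (starRingEnd ℂ) (F i y) * u y) * F i x) * (starRingEnd ℂ) (w x)
            = (weilGroundEnergy a : ℂ) *
                (∫ x, (∑ i, (∫ y, (starRingEnd ℂ) (F i y) * u y) * F i x) * (starRingEnd ℂ) (w x))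
              + ∫ x, s x * (starRingEnd ℂ) (w x)) := by
  intro b₀ A hb₀ hb₀A
  obtain ⟨c, hc, hca⟩ := hfloor b₀ A hb₀ hb₀A
  refine ⟨c, 0, 1, hc, le_rfl, one_pos, ?_⟩
  intro a ha haA
  refine ⟨0, fun i ↦ Fin.elim0 i, fun i ↦ Fin.elim0 i, fun i ↦ Fin.elim0 i, ?_, ?_⟩
  · intro g hg hgs _
    exact (mul_le_mul_of_nonneg_right (hca a ha haA) (integral_nonneg fun _ ↦ by positivity)).trans
      (ConnesVanSuijlekom.weilGroundEnergy_mul_le_re hg hgs)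
  · intro u _
    refine ⟨0, measurable_const, fun x ↦ by simp, ?_⟩
    intro w _ _ _
    simp

/-! ### The composition -/

/-- **Core glue `diniLeakage_of_stubs`** (sorry-free; hypotheses are the STATEMENTS (S1′) shadow core, (S2′) boundary law,
(S3′) = (S1′) → (S2′) → relative edge mass, (S4′) = relative edge mass with slack → relative commutator; conclusion: the
crux UNFOLDED verbatim — `DiniLeakage_of` below is the one theorem that concludes it BY NAME, from the stubs by name,
as the skeleton audit `#h21_check_skeleton` requires).
Proof (real, no `sorry`): (S3′) and (S4′) turn (S1′), (S2′) into the relative commutator bound on the range `[b₀, A+1]`;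
for `a ∈ [b₀, A]`, `η, δ > 0` take `h := min(h₀(η/2), δ/2, 1)`, a ground state `u` of the LARGER window `a + h`
(`ConnesConsaniMoscovici2025_thm_3_6_holds.exists_isWeilGroundState`, PROVED) and the piecewise-linear cutoff
`χ(x) = max(min((a − |x|)/h, 1), 0)` (`= 1` on `|x| ≤ a − h`, `= 0` on `|x| ≥ a`, slope `1/h`); the LANDED
localised-cut inequality `…Theorems.WeilWindowFlowWindowLipschitz.stub_localizedCut` (with its landed antecedents
`stub_formDomainPos`, `stub_groundStateEnergy`, `stub_eulerLagrange`) at the windows `a ≤ a + h` and (S4′) at the window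
`a + h` give `(ε(a) − ε(a+h)) · ½ ≤ h (K ε(a+h) + η/2)`; antitonicity `ε(a+h) ≤ ε(a)` and `K ≥ 0` finish with the
crux constant `2K`. -/
theorem diniLeakage_of_stubs :
    (∀ b₀ A : ℝ, 0 < b₀ → b₀ ≤ A → ∃ c κ d : ℝ, 0 < c ∧ 0 ≤ κ ∧ 0 < d ∧
      ∀ a : ℝ, b₀ ≤ a → a ≤ A → ∃ (N : ℕ) (F : Fin N → ℝ → ℂ),
        (∀ i, IsWeilTest (F i) ∧ tsupport (F i) ⊆ Icc (-(a - d)) (a - d) ∧ ∀ x, ‖F i x‖ ≤ κ) ∧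
        (∀ i j, ∫ x, (starRingEnd ℂ) (F i x) * F j x = if i = j then 1 else 0) ∧
        (∀ g : ℝ → ℂ, IsWeilTest g → tsupport g ⊆ Icc (-a) a →
          (∀ i, ∫ x, (starRingEnd ℂ) (F i x) * g x = 0) → c * ∫ x, ‖g x‖ ^ 2 ≤ (weilQuadratic g).re) ∧
        (∀ u : ℝ → ℂ, IsWeilGroundState a u → ∃ s : ℝ → ℂ, Measurable s ∧
          (∀ x, ‖s x‖ ^ 2 ≤ κ * weilGroundEnergy a) ∧
          ∀ w : ℝ → ℂ, MemLp w 2 → (∀ᵐ x : ℝ, x ∉ Icc (-a) a → w x = 0) →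
              IntegrableOn (fun t ↦ weilArchDensity t * weilIncrement w t) (Ioi 0) →
            2 * (∫ x, (∑ i, (∫ y, (starRingEnd ℂ) (F i y) * u y) * F i x) * (Real.cosh (x / 2) : ℂ)) *
                (starRingEnd ℂ) (∫ x, w x * (Real.cosh (x / 2) : ℂ))
              - 2 * (∫ x, (∑ i, (∫ y, (starRingEnd ℂ) (F i y) * u y) * F i x) * (Real.sinh (x / 2) : ℂ)) *
                (starRingEnd ℂ) (∫ x, w x * (Real.sinh (x / 2) : ℂ))
              + (∑ n ∈ weilPrimeIndex a, (((ArithmeticFunction.vonMangoldt n : ℝ) / Real.sqrt n : ℝ) : ℂ) *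
                  ∫ x, ((∑ i, (∫ y, (starRingEnd ℂ) (F i y) * u y) * F i (x + Real.log n)) -
                        (∑ i, (∫ y, (starRingEnd ℂ) (F i y) * u y) * F i x)) *
                    (starRingEnd ℂ) (w (x + Real.log n) - w x))
              + (∫ t in Ioi (0 : ℝ), (weilArchDensity t : ℂ) *
                  ∫ x, ((∑ i, (∫ y, (starRingEnd ℂ) (F i y) * u y) * F i (x + t)) -
                        (∑ i, (∫ y, (starRingEnd ℂ) (F i y) * u y) * F i x)) *
                    (starRingEnd ℂ) (w (x + t) - w x))
              - (weilMarkovConstant a : ℂ) *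
                  ∫ x, (∑ i, (∫ y, (starRingEnd ℂ) (F i y) * u y) * F i x) * (starRingEnd ℂ) (w x)
            = (weilGroundEnergy a : ℂ) *
                (∫ x, (∑ i, (∫ y, (starRingEnd ℂ) (F i y) * u y) * F i x) * (starRingEnd ℂ) (w x))
              + ∫ x, s x * (starRingEnd ℂ) (w x))) →
    (∀ b₀ A Λ₀ : ℝ, 0 < b₀ → b₀ ≤ A → ∃ C r₀ : ℝ, 0 ≤ C ∧ 0 < r₀ ∧ r₀ < 1 ∧
      ∀ (a lam σ : ℝ) (w s : ℝ → ℂ), b₀ ≤ a → a ≤ A → |lam| ≤ Λ₀ → 0 ≤ σ →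
        MemLp w 2 → (∀ᵐ x : ℝ, x ∉ Icc (-a) a → w x = 0) →
        IntegrableOn (fun t ↦ weilArchDensity t * weilIncrement w t) (Ioi 0) →
        (∀ᵐ x : ℝ, ‖w x‖ ≤ σ) → Measurable s → (∀ x, ‖s x‖ ≤ σ) →
        (∀ φ : ℝ → ℂ, MemLp φ 2 → (∀ᵐ x : ℝ, x ∉ Icc (-a) a → φ x = 0) →
            IntegrableOn (fun t ↦ weilArchDensity t * weilIncrement φ t) (Ioi 0) →
          2 * (∫ x, w x * (Real.cosh (x / 2) : ℂ)) * (starRingEnd ℂ) (∫ x, φ x * (Real.cosh (x / 2) : ℂ))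
            - 2 * (∫ x, w x * (Real.sinh (x / 2) : ℂ)) * (starRingEnd ℂ) (∫ x, φ x * (Real.sinh (x / 2) : ℂ))
            + (∑ n ∈ weilPrimeIndex a, (((ArithmeticFunction.vonMangoldt n : ℝ) / Real.sqrt n : ℝ) : ℂ) *
                ∫ x, (w (x + Real.log n) - w x) * (starRingEnd ℂ) (φ (x + Real.log n) - φ x))
            + (∫ t in Ioi (0 : ℝ), (weilArchDensity t : ℂ) *
                ∫ x, (w (x + t) - w x) * (starRingEnd ℂ) (φ (x + t) - φ x))
            - (weilMarkovConstant a : ℂ) * ∫ x, w x * (starRingEnd ℂ) (φ x)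
          = (lam : ℂ) * (∫ x, w x * (starRingEnd ℂ) (φ x)) + ∫ x, s x * (starRingEnd ℂ) (φ x)) →
        ∀ r : ℝ, 0 < r → r ≤ r₀ →
          ∫ x in {x : ℝ | a - r < |x|}, ‖w x‖ ^ 2 ≤ C * σ ^ 2 * r / Real.log (1 / r)) →
    ((∀ b₀ A : ℝ, 0 < b₀ → b₀ ≤ A → ∃ c κ d : ℝ, 0 < c ∧ 0 ≤ κ ∧ 0 < d ∧
      ∀ a : ℝ, b₀ ≤ a → a ≤ A → ∃ (N : ℕ) (F : Fin N → ℝ → ℂ),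
        (∀ i, IsWeilTest (F i) ∧ tsupport (F i) ⊆ Icc (-(a - d)) (a - d) ∧ ∀ x, ‖F i x‖ ≤ κ) ∧
        (∀ i j, ∫ x, (starRingEnd ℂ) (F i x) * F j x = if i = j then 1 else 0) ∧
        (∀ g : ℝ → ℂ, IsWeilTest g → tsupport g ⊆ Icc (-a) a →
          (∀ i, ∫ x, (starRingEnd ℂ) (F i x) * g x = 0) → c * ∫ x, ‖g x‖ ^ 2 ≤ (weilQuadratic g).re) ∧
        (∀ u : ℝ → ℂ, IsWeilGroundState a u → ∃ s : ℝ → ℂ, Measurable s ∧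
          (∀ x, ‖s x‖ ^ 2 ≤ κ * weilGroundEnergy a) ∧
          ∀ w : ℝ → ℂ, MemLp w 2 → (∀ᵐ x : ℝ, x ∉ Icc (-a) a → w x = 0) →
              IntegrableOn (fun t ↦ weilArchDensity t * weilIncrement w t) (Ioi 0) →
            2 * (∫ x, (∑ i, (∫ y, (starRingEnd ℂ) (F i y) * u y) * F i x) * (Real.cosh (x / 2) : ℂ)) *
                (starRingEnd ℂ) (∫ x, w x * (Real.cosh (x / 2) : ℂ))
              - 2 * (∫ x, (∑ i, (∫ y, (starRingEnd ℂ) (F i y) * u y) * F i x) * (Real.sinh (x / 2) : ℂ)) *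
                (starRingEnd ℂ) (∫ x, w x * (Real.sinh (x / 2) : ℂ))
              + (∑ n ∈ weilPrimeIndex a, (((ArithmeticFunction.vonMangoldt n : ℝ) / Real.sqrt n : ℝ) : ℂ) *
                  ∫ x, ((∑ i, (∫ y, (starRingEnd ℂ) (F i y) * u y) * F i (x + Real.log n)) -
                        (∑ i, (∫ y, (starRingEnd ℂ) (F i y) * u y) * F i x)) *
                    (starRingEnd ℂ) (w (x + Real.log n) - w x))
              + (∫ t in Ioi (0 : ℝ), (weilArchDensity t : ℂ) *
                  ∫ x, ((∑ i, (∫ y, (starRingEnd ℂ) (F i y) * u y) * F i (x + t)) -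
                        (∑ i, (∫ y, (starRingEnd ℂ) (F i y) * u y) * F i x)) *
                    (starRingEnd ℂ) (w (x + t) - w x))
              - (weilMarkovConstant a : ℂ) *
                  ∫ x, (∑ i, (∫ y, (starRingEnd ℂ) (F i y) * u y) * F i x) * (starRingEnd ℂ) (w x)
            = (weilGroundEnergy a : ℂ) *
                (∫ x, (∑ i, (∫ y, (starRingEnd ℂ) (F i y) * u y) * F i x) * (starRingEnd ℂ) (w x))
              + ∫ x, s x * (starRingEnd ℂ) (w x))) →
      (∀ b₀ A Λ₀ : ℝ, 0 < b₀ → b₀ ≤ A → ∃ C r₀ : ℝ, 0 ≤ C ∧ 0 < r₀ ∧ r₀ < 1 ∧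
      ∀ (a lam σ : ℝ) (w s : ℝ → ℂ), b₀ ≤ a → a ≤ A → |lam| ≤ Λ₀ → 0 ≤ σ →
        MemLp w 2 → (∀ᵐ x : ℝ, x ∉ Icc (-a) a → w x = 0) →
        IntegrableOn (fun t ↦ weilArchDensity t * weilIncrement w t) (Ioi 0) →
        (∀ᵐ x : ℝ, ‖w x‖ ≤ σ) → Measurable s → (∀ x, ‖s x‖ ≤ σ) →
        (∀ φ : ℝ → ℂ, MemLp φ 2 → (∀ᵐ x : ℝ, x ∉ Icc (-a) a → φ x = 0) →
            IntegrableOn (fun t ↦ weilArchDensity t * weilIncrement φ t) (Ioi 0) →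
          2 * (∫ x, w x * (Real.cosh (x / 2) : ℂ)) * (starRingEnd ℂ) (∫ x, φ x * (Real.cosh (x / 2) : ℂ))
            - 2 * (∫ x, w x * (Real.sinh (x / 2) : ℂ)) * (starRingEnd ℂ) (∫ x, φ x * (Real.sinh (x / 2) : ℂ))
            + (∑ n ∈ weilPrimeIndex a, (((ArithmeticFunction.vonMangoldt n : ℝ) / Real.sqrt n : ℝ) : ℂ) *
                ∫ x, (w (x + Real.log n) - w x) * (starRingEnd ℂ) (φ (x + Real.log n) - φ x))
            + (∫ t in Ioi (0 : ℝ), (weilArchDensity t : ℂ) *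
                ∫ x, (w (x + t) - w x) * (starRingEnd ℂ) (φ (x + t) - φ x))
            - (weilMarkovConstant a : ℂ) * ∫ x, w x * (starRingEnd ℂ) (φ x)
          = (lam : ℂ) * (∫ x, w x * (starRingEnd ℂ) (φ x)) + ∫ x, s x * (starRingEnd ℂ) (φ x)) →
        ∀ r : ℝ, 0 < r → r ≤ r₀ →
          ∫ x in {x : ℝ | a - r < |x|}, ‖w x‖ ^ 2 ≤ C * σ ^ 2 * r / Real.log (1 / r)) →
      ∀ b₀ A : ℝ, 0 < b₀ → b₀ ≤ A → ∃ K r₀ : ℝ, 0 ≤ K ∧ 0 < r₀ ∧ r₀ < 1 ∧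
      ∀ (a r : ℝ) (u : ℝ → ℂ), b₀ ≤ a → a ≤ A → IsWeilGroundState a u → 0 < r → r ≤ r₀ →
        ∫ x in {x : ℝ | a - r < |x|}, ‖u x‖ ^ 2 ≤ K * weilGroundEnergy a * r / Real.log (1 / r)) →
    ((∀ b₀ A : ℝ, 0 < b₀ → b₀ ≤ A → ∃ K : ℝ, 0 ≤ K ∧ ∀ η : ℝ, 0 < η → ∃ r₀ : ℝ, 0 < r₀ ∧ r₀ < 1 ∧
      ∀ (a r : ℝ) (u : ℝ → ℂ), b₀ ≤ a → a ≤ A → IsWeilGroundState a u → 0 < r → r ≤ r₀ →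
        ∫ x in {x : ℝ | a - r < |x|}, ‖u x‖ ^ 2 ≤
          (K * weilGroundEnergy a + η) * r / Real.log (1 / r)) →
      ∀ b₀ A : ℝ, 0 < b₀ → b₀ ≤ A → ∃ K : ℝ, 0 ≤ K ∧ ∀ η : ℝ, 0 < η → ∃ h₀ : ℝ, 0 < h₀ ∧
        ∀ (a h : ℝ) (u : ℝ → ℂ) (χ : ℝ → ℝ), b₀ ≤ a → a ≤ A → 0 < h → h ≤ h₀ →
        IsWeilGroundState a u → (∀ x y, |χ x - χ y| ≤ |x - y| / h) → (∀ x, 0 ≤ χ x ∧ χ x ≤ 1) →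
        (∀ x, |x| ≤ a - 2 * h → χ x = 1) → (∀ x, a - h ≤ |x| → χ x = 0) →
        (∫ t in Ioi (0 : ℝ), weilArchDensity t *
              ∫ x, (χ (x + t) - χ x) ^ 2 * (‖u (x + t)‖ * ‖u x‖)) +
          (∑ n ∈ weilPrimeIndex a, (ArithmeticFunction.vonMangoldt n : ℝ) / Real.sqrt n *
              ∫ x, (χ (x + Real.log n) - χ x) ^ 2 * (‖u (x + Real.log n)‖ * ‖u x‖)) +
          2 * ‖∫ t, ((1 - χ t : ℝ) : ℂ) * u t * (Real.cosh (t / 2) : ℂ)‖ ^ 2 +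
          2 * ‖∫ t, u t * (Real.cosh (t / 2) : ℂ)‖ *
              ‖∫ t, (((1 - χ t) ^ 2 : ℝ) : ℂ) * u t * (Real.cosh (t / 2) : ℂ)‖ +
          2 * ‖∫ t, u t * (Real.sinh (t / 2) : ℂ)‖ *
              ‖∫ t, (((1 - χ t) ^ 2 : ℝ) : ℂ) * u t * (Real.sinh (t / 2) : ℂ)‖ ≤
            h * (K * weilGroundEnergy a + η) ∧
          1 / 2 ≤ ∫ x, ‖(χ x : ℂ) * u x‖ ^ 2) →
    ∀ b₀ A : ℝ, 0 < b₀ → b₀ ≤ A → ∃ K : ℝ, ∀ a : ℝ, b₀ ≤ a → a ≤ A → ∀ η δ : ℝ, 0 < η → 0 < δ →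
      ∃ h : ℝ, 0 < h ∧ h < δ ∧
        weilGroundEnergy a - weilGroundEnergy (a + h) ≤ h * (K * weilGroundEnergy a + η) := by
  intro h1 h2 h3 h4
  have hE := h4 (relEdgeMassEta_of (h3 h1 h2))
  -- the LANDED localised-cut inequality, closed by its LANDED antecedents (C1), (C2), (EL)
  have hD :=
    _root_.Summit.RiemannHypothesis.RiemannHypothesis.Theorems.WeilWindowFlowWindowLipschitz.stub_localizedCut
      _root_.Summit.RiemannHypothesis.RiemannHypothesis.Theorems.WeilWindowFlowWindowLipschitz.stub_formDomainPos
      _root_.Summit.RiemannHypothesis.RiemannHypothesis.Theorems.WeilWindowFlowWindowLipschitz.stub_groundStateEnergy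
      (_root_.Summit.RiemannHypothesis.RiemannHypothesis.Theorems.WeilWindowFlowWindowLipschitz.stub_eulerLagrange
        _root_.Summit.RiemannHypothesis.RiemannHypothesis.Theorems.WeilWindowFlowWindowLipschitz.stub_formDomainPos
        _root_.Summit.RiemannHypothesis.RiemannHypothesis.Theorems.WeilWindowFlowWindowLipschitz.stub_groundStateEnergy)
  intro b₀ A hb₀ hb₀A
  obtain ⟨K, hK0, hKη⟩ := hE b₀ (A + 1) hb₀ (by linarith)
  refine ⟨2 * K, ?_⟩
  intro a ha haA η δ hη hδ
  obtain ⟨h₀, hh₀, hest⟩ := hKη (η / 2) (by positivity)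
  -- the width `h := min (min h₀ (δ / 2)) 1`
  set h : ℝ := min (min h₀ (δ / 2)) 1 with hhdef
  have hh : 0 < h := lt_min (lt_min hh₀ (by linarith)) one_pos
  have hhh₀ : h ≤ h₀ := (min_le_left _ _).trans (min_le_left _ _)
  have hhδ : h < δ := lt_of_le_of_lt ((min_le_left _ _).trans (min_le_right _ _)) (by linarith)
  have hh1 : h ≤ 1 := min_le_right _ _
  refine ⟨h, hh, hhδ, ?_⟩
  have ha0 : 0 < a := lt_of_lt_of_le hb₀ ha
  have hb : 0 < a + h := by linarith
  -- a TRUE ground state of the LARGER window `a + h`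
  obtain ⟨u, hu⟩ := ConnesConsaniMoscovici2025_thm_3_6_holds.exists_isWeilGroundState hb
  -- the piecewise-linear cutoff of width `h` adapted to the windows `a ≤ a + h`
  set χ : ℝ → ℝ := fun x ↦ max (min ((a - |x|) / h) 1) 0 with hχdef
  have hχ01 : ∀ x, 0 ≤ χ x ∧ χ x ≤ 1 := fun x ↦
    ⟨le_max_right _ _, max_le (min_le_right _ _) zero_le_one⟩
  have hχone : ∀ x, |x| ≤ a + h - 2 * h → χ x = 1 := by
    intro x hx
    have h1p : 1 ≤ (a - |x|) / h := by
      rw [le_div_iff₀ hh]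
      linarith
    show max (min ((a - |x|) / h) 1) 0 = 1
    rw [min_eq_right h1p, max_eq_left (zero_le_one' ℝ)]
  have hχzero : ∀ x, a + h - h ≤ |x| → χ x = 0 := by
    intro x hx
    have hp : (a - |x|) / h ≤ 0 := by
      rw [div_le_iff₀ hh, zero_mul]
      linarith
    show max (min ((a - |x|) / h) 1) 0 = 0
    exact max_eq_right ((min_le_left _ _).trans hp)
  have hχzero' : ∀ x, a ≤ |x| → χ x = 0 := fun x hx ↦ hχzero x (by linarith)
  have hχlip : ∀ x y, |χ x - χ y| ≤ |x - y| / h := by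
    intro x y
    calc |χ x - χ y|
        = |max (min ((a - |x|) / h) 1) 0 - max (min ((a - |y|) / h) 1) 0| := rfl
      _ ≤ |min ((a - |x|) / h) 1 - min ((a - |y|) / h) 1| := abs_max_sub_max_le_abs _ _ _
      _ ≤ max |(a - |x|) / h - (a - |y|) / h| |(1 : ℝ) - 1| := abs_min_sub_min_le_max _ _ _ _
      _ = |(a - |x|) / h - (a - |y|) / h| := by
          rw [sub_self, abs_zero, max_eq_left (abs_nonneg _)]
      _ = |(|y| - |x|)| / h := by
          rw [show (a - |x|) / h - (a - |y|) / h = (|y| - |x|) / h by ring, abs_div, abs_of_pos hh]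
      _ ≤ |x - y| / h := by
          rw [div_le_div_iff_of_pos_right hh, abs_sub_comm x y]
          exact abs_abs_sub_abs_le_abs_sub y x
  have hχLW : LipschitzWith (Real.toNNReal (1 / h)) χ := by
    refine LipschitzWith.of_dist_le_mul fun x y ↦ ?_
    rw [Real.dist_eq, Real.dist_eq, Real.coe_toNNReal _ (by positivity)]
    calc |χ x - χ y| ≤ |x - y| / h := hχlip x y
      _ = 1 / h * |x - y| := by ring
  -- (D) at the windows `a ≤ a + h`, and (S4′) at the window `a + h ∈ [b₀, A + 1]`
  have hcut := hD (a + h) a (Real.toNNReal (1 / h)) u χ ha0 (by linarith) hu hχLW hχ01 hχzero'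
  obtain ⟨hR, hm⟩ :=
    hest (a + h) h u χ (by linarith) (by linarith) hh hhh₀ hu hχlip hχ01 hχone hχzero
  have hanti : weilGroundEnergy (a + h) ≤ weilGroundEnergy a := eps_antitone ha0 (by linarith)
  have hnn : 0 ≤ weilGroundEnergy a - weilGroundEnergy (a + h) := sub_nonneg.2 hanti
  have hstep : (weilGroundEnergy a - weilGroundEnergy (a + h)) * (1 / 2) ≤
      h * (K * weilGroundEnergy (a + h) + η / 2) :=
    le_trans (mul_le_mul_of_nonneg_left hm hnn) (hcut.trans hR)
  have hmono : h * (K * weilGroundEnergy (a + h) + η / 2) ≤ h * (K * weilGroundEnergy a + η / 2) :=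
    mul_le_mul_of_nonneg_left (by nlinarith [mul_le_mul_of_nonneg_left hanti hK0]) hh.le
  linarith [hstep, hmono]

/-- **`DiniLeakage` from the five registered stubs BY NAME** — the skeleton's crux proof term and the ONLY theorem of
this file whose conclusion is the route decl `Summit.RiemannHypothesis.RiemannHypothesis.Theses.WeilWindowFlow.DiniLeakage`
(so the audit's "first candidate" is unambiguous): (S1) `stub_shadowCore` fed with (S0) `stub_radicalIdentity`,
(S2) `stub_boundaryLaw`, (S3) `stub_shadowEdgeMass`, (S4) `stub_relativeCommutator`, composed by the sorry-free
`diniLeakage_of_stubs`.  No hypotheses; `sorry` only inside the five `stub_*`. -/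
theorem DiniLeakage_of : DiniLeakage :=
  diniLeakage_of_stubs (stub_shadowCore stub_radicalIdentity) stub_boundaryLaw stub_shadowEdgeMass
    stub_relativeCommutator

/-- **The regularity half, isolated** (sorry-free modulo the statements of the UNCONDITIONAL stubs (S2), (S3), (S4);
conclusion = the crux unfolded): a positive floor for `ε` on every compact window range implies `DiniLeakage`.  This is
the typed content of the reduction "crux = positivity ∧ relative-Lipschitz shape" (cdisprove
`diniLeakage_iff_pos_and_lowerRightLipschitz`): the shape is discharged by the edge-mass/commutator analysis, and what is
left of the crux is exactly local strict Weil positivity (RH-strength).  The radical block (S0)/(S1) is where the line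
proposes to EARN the floor-free case. -/
theorem diniLeakage_of_strictFloor
    (hfloor : ∀ b₀ A : ℝ, 0 < b₀ → b₀ ≤ A → ∃ c : ℝ, 0 < c ∧
      ∀ a : ℝ, b₀ ≤ a → a ≤ A → c ≤ weilGroundEnergy a) :
    (∀ b₀ A Λ₀ : ℝ, 0 < b₀ → b₀ ≤ A → ∃ C r₀ : ℝ, 0 ≤ C ∧ 0 < r₀ ∧ r₀ < 1 ∧
      ∀ (a lam σ : ℝ) (w s : ℝ → ℂ), b₀ ≤ a → a ≤ A → |lam| ≤ Λ₀ → 0 ≤ σ →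
        MemLp w 2 → (∀ᵐ x : ℝ, x ∉ Icc (-a) a → w x = 0) →
        IntegrableOn (fun t ↦ weilArchDensity t * weilIncrement w t) (Ioi 0) →
        (∀ᵐ x : ℝ, ‖w x‖ ≤ σ) → Measurable s → (∀ x, ‖s x‖ ≤ σ) →
        (∀ φ : ℝ → ℂ, MemLp φ 2 → (∀ᵐ x : ℝ, x ∉ Icc (-a) a → φ x = 0) →
            IntegrableOn (fun t ↦ weilArchDensity t * weilIncrement φ t) (Ioi 0) →
          2 * (∫ x, w x * (Real.cosh (x / 2) : ℂ)) * (starRingEnd ℂ) (∫ x, φ x * (Real.cosh (x / 2) : ℂ))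
            - 2 * (∫ x, w x * (Real.sinh (x / 2) : ℂ)) * (starRingEnd ℂ) (∫ x, φ x * (Real.sinh (x / 2) : ℂ))
            + (∑ n ∈ weilPrimeIndex a, (((ArithmeticFunction.vonMangoldt n : ℝ) / Real.sqrt n : ℝ) : ℂ) *
                ∫ x, (w (x + Real.log n) - w x) * (starRingEnd ℂ) (φ (x + Real.log n) - φ x))
            + (∫ t in Ioi (0 : ℝ), (weilArchDensity t : ℂ) *
                ∫ x, (w (x + t) - w x) * (starRingEnd ℂ) (φ (x + t) - φ x))
            - (weilMarkovConstant a : ℂ) * ∫ x, w x * (starRingEnd ℂ) (φ x)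
          = (lam : ℂ) * (∫ x, w x * (starRingEnd ℂ) (φ x)) + ∫ x, s x * (starRingEnd ℂ) (φ x)) →
        ∀ r : ℝ, 0 < r → r ≤ r₀ →
          ∫ x in {x : ℝ | a - r < |x|}, ‖w x‖ ^ 2 ≤ C * σ ^ 2 * r / Real.log (1 / r)) →
    ((∀ b₀ A : ℝ, 0 < b₀ → b₀ ≤ A → ∃ c κ d : ℝ, 0 < c ∧ 0 ≤ κ ∧ 0 < d ∧
      ∀ a : ℝ, b₀ ≤ a → a ≤ A → ∃ (N : ℕ) (F : Fin N → ℝ → ℂ),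
        (∀ i, IsWeilTest (F i) ∧ tsupport (F i) ⊆ Icc (-(a - d)) (a - d) ∧ ∀ x, ‖F i x‖ ≤ κ) ∧
        (∀ i j, ∫ x, (starRingEnd ℂ) (F i x) * F j x = if i = j then 1 else 0) ∧
        (∀ g : ℝ → ℂ, IsWeilTest g → tsupport g ⊆ Icc (-a) a →
          (∀ i, ∫ x, (starRingEnd ℂ) (F i x) * g x = 0) → c * ∫ x, ‖g x‖ ^ 2 ≤ (weilQuadratic g).re) ∧
        (∀ u : ℝ → ℂ, IsWeilGroundState a u → ∃ s : ℝ → ℂ, Measurable s ∧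
          (∀ x, ‖s x‖ ^ 2 ≤ κ * weilGroundEnergy a) ∧
          ∀ w : ℝ → ℂ, MemLp w 2 → (∀ᵐ x : ℝ, x ∉ Icc (-a) a → w x = 0) →
              IntegrableOn (fun t ↦ weilArchDensity t * weilIncrement w t) (Ioi 0) →
            2 * (∫ x, (∑ i, (∫ y, (starRingEnd ℂ) (F i y) * u y) * F i x) * (Real.cosh (x / 2) : ℂ)) *
                (starRingEnd ℂ) (∫ x, w x * (Real.cosh (x / 2) : ℂ))
              - 2 * (∫ x, (∑ i, (∫ y, (starRingEnd ℂ) (F i y) * u y) * F i x) * (Real.sinh (x / 2) : ℂ)) *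
                (starRingEnd ℂ) (∫ x, w x * (Real.sinh (x / 2) : ℂ))
              + (∑ n ∈ weilPrimeIndex a, (((ArithmeticFunction.vonMangoldt n : ℝ) / Real.sqrt n : ℝ) : ℂ) *
                  ∫ x, ((∑ i, (∫ y, (starRingEnd ℂ) (F i y) * u y) * F i (x + Real.log n)) -
                        (∑ i, (∫ y, (starRingEnd ℂ) (F i y) * u y) * F i x)) *
                    (starRingEnd ℂ) (w (x + Real.log n) - w x))
              + (∫ t in Ioi (0 : ℝ), (weilArchDensity t : ℂ) *
                  ∫ x, ((∑ i, (∫ y, (starRingEnd ℂ) (F i y) * u y) * F i (x + t)) -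
                        (∑ i, (∫ y, (starRingEnd ℂ) (F i y) * u y) * F i x)) *
                    (starRingEnd ℂ) (w (x + t) - w x))
              - (weilMarkovConstant a : ℂ) *
                  ∫ x, (∑ i, (∫ y, (starRingEnd ℂ) (F i y) * u y) * F i x) * (starRingEnd ℂ) (w x)
            = (weilGroundEnergy a : ℂ) *
                (∫ x, (∑ i, (∫ y, (starRingEnd ℂ) (F i y) * u y) * F i x) * (starRingEnd ℂ) (w x))
              + ∫ x, s x * (starRingEnd ℂ) (w x))) →
      (∀ b₀ A Λ₀ : ℝ, 0 < b₀ → b₀ ≤ A → ∃ C r₀ : ℝ, 0 ≤ C ∧ 0 < r₀ ∧ r₀ < 1 ∧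
      ∀ (a lam σ : ℝ) (w s : ℝ → ℂ), b₀ ≤ a → a ≤ A → |lam| ≤ Λ₀ → 0 ≤ σ →
        MemLp w 2 → (∀ᵐ x : ℝ, x ∉ Icc (-a) a → w x = 0) →
        IntegrableOn (fun t ↦ weilArchDensity t * weilIncrement w t) (Ioi 0) →
        (∀ᵐ x : ℝ, ‖w x‖ ≤ σ) → Measurable s → (∀ x, ‖s x‖ ≤ σ) →
        (∀ φ : ℝ → ℂ, MemLp φ 2 → (∀ᵐ x : ℝ, x ∉ Icc (-a) a → φ x = 0) →
            IntegrableOn (fun t ↦ weilArchDensity t * weilIncrement φ t) (Ioi 0) →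
          2 * (∫ x, w x * (Real.cosh (x / 2) : ℂ)) * (starRingEnd ℂ) (∫ x, φ x * (Real.cosh (x / 2) : ℂ))
            - 2 * (∫ x, w x * (Real.sinh (x / 2) : ℂ)) * (starRingEnd ℂ) (∫ x, φ x * (Real.sinh (x / 2) : ℂ))
            + (∑ n ∈ weilPrimeIndex a, (((ArithmeticFunction.vonMangoldt n : ℝ) / Real.sqrt n : ℝ) : ℂ) *
                ∫ x, (w (x + Real.log n) - w x) * (starRingEnd ℂ) (φ (x + Real.log n) - φ x))
            + (∫ t in Ioi (0 : ℝ), (weilArchDensity t : ℂ) *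
                ∫ x, (w (x + t) - w x) * (starRingEnd ℂ) (φ (x + t) - φ x))
            - (weilMarkovConstant a : ℂ) * ∫ x, w x * (starRingEnd ℂ) (φ x)
          = (lam : ℂ) * (∫ x, w x * (starRingEnd ℂ) (φ x)) + ∫ x, s x * (starRingEnd ℂ) (φ x)) →
        ∀ r : ℝ, 0 < r → r ≤ r₀ →
          ∫ x in {x : ℝ | a - r < |x|}, ‖w x‖ ^ 2 ≤ C * σ ^ 2 * r / Real.log (1 / r)) →
      ∀ b₀ A : ℝ, 0 < b₀ → b₀ ≤ A → ∃ K r₀ : ℝ, 0 ≤ K ∧ 0 < r₀ ∧ r₀ < 1 ∧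
      ∀ (a r : ℝ) (u : ℝ → ℂ), b₀ ≤ a → a ≤ A → IsWeilGroundState a u → 0 < r → r ≤ r₀ →
        ∫ x in {x : ℝ | a - r < |x|}, ‖u x‖ ^ 2 ≤ K * weilGroundEnergy a * r / Real.log (1 / r)) →
    ((∀ b₀ A : ℝ, 0 < b₀ → b₀ ≤ A → ∃ K : ℝ, 0 ≤ K ∧ ∀ η : ℝ, 0 < η → ∃ r₀ : ℝ, 0 < r₀ ∧ r₀ < 1 ∧
      ∀ (a r : ℝ) (u : ℝ → ℂ), b₀ ≤ a → a ≤ A → IsWeilGroundState a u → 0 < r → r ≤ r₀ →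
        ∫ x in {x : ℝ | a - r < |x|}, ‖u x‖ ^ 2 ≤
          (K * weilGroundEnergy a + η) * r / Real.log (1 / r)) →
      ∀ b₀ A : ℝ, 0 < b₀ → b₀ ≤ A → ∃ K : ℝ, 0 ≤ K ∧ ∀ η : ℝ, 0 < η → ∃ h₀ : ℝ, 0 < h₀ ∧
        ∀ (a h : ℝ) (u : ℝ → ℂ) (χ : ℝ → ℝ), b₀ ≤ a → a ≤ A → 0 < h → h ≤ h₀ →
        IsWeilGroundState a u → (∀ x y, |χ x - χ y| ≤ |x - y| / h) → (∀ x, 0 ≤ χ x ∧ χ x ≤ 1) →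
        (∀ x, |x| ≤ a - 2 * h → χ x = 1) → (∀ x, a - h ≤ |x| → χ x = 0) →
        (∫ t in Ioi (0 : ℝ), weilArchDensity t *
              ∫ x, (χ (x + t) - χ x) ^ 2 * (‖u (x + t)‖ * ‖u x‖)) +
          (∑ n ∈ weilPrimeIndex a, (ArithmeticFunction.vonMangoldt n : ℝ) / Real.sqrt n *
              ∫ x, (χ (x + Real.log n) - χ x) ^ 2 * (‖u (x + Real.log n)‖ * ‖u x‖)) +
          2 * ‖∫ t, ((1 - χ t : ℝ) : ℂ) * u t * (Real.cosh (t / 2) : ℂ)‖ ^ 2 +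
          2 * ‖∫ t, u t * (Real.cosh (t / 2) : ℂ)‖ *
              ‖∫ t, (((1 - χ t) ^ 2 : ℝ) : ℂ) * u t * (Real.cosh (t / 2) : ℂ)‖ +
          2 * ‖∫ t, u t * (Real.sinh (t / 2) : ℂ)‖ *
              ‖∫ t, (((1 - χ t) ^ 2 : ℝ) : ℂ) * u t * (Real.sinh (t / 2) : ℂ)‖ ≤
            h * (K * weilGroundEnergy a + η) ∧
          1 / 2 ≤ ∫ x, ‖(χ x : ℂ) * u x‖ ^ 2) →
    ∀ b₀ A : ℝ, 0 < b₀ → b₀ ≤ A → ∃ K : ℝ, ∀ a : ℝ, b₀ ≤ a → a ≤ A → ∀ η δ : ℝ, 0 < η → 0 < δ →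
      ∃ h : ℝ, 0 < h ∧ h < δ ∧
        weilGroundEnergy a - weilGroundEnergy (a + h) ≤ h * (K * weilGroundEnergy a + η) :=
  fun h2 h3 h4 ↦ diniLeakage_of_stubs (shadowCore_of_strictFloor hfloor) h2 h3 h4

end Summit.RiemannHypothesis.RiemannHypothesis.Cruxes.DiniLeakage.RadicalShadowSlepianEdge

end

/-! ### Costume certificate (line lead `prover-line-stmt-RiemannHypothesis-1038-1`, 2026-08-16)

Since 2026-08-16T08:12Z the TREE holds
`Summit.RiemannHypothesis.RiemannHypothesis.Theorems.WeilWindowFlowDiniLeakage.diniLeakage_iff_mathlib_riemannHypothesis :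
DiniLeakage ↔ RiemannHypothesis` (p90716; axioms `propext/Classical.choice/Quot.sound`) and
`…Theorems.strictUnderRH_proof : StrictUnderRH` (item 1043).  Read through them (all sorry-free below, hypothesis form):
* the statements of the five registered stubs prove Mathlib's `RiemannHypothesis` (`riemannHypothesis_of_stubs`);
* `RiemannHypothesis → (S1)` AS TYPED, with the EMPTY block (`stub_shadowCore_of_riemannHypothesis`: RH ⟹ strict floor on
  every compact range by `strictUnderRH_proof` + antitonicity ⟹ (S1′) by the planner's own `shadowCore_of_strictFloor`);
* hence, GIVEN the four unconditional stubs (S0), (S2), (S3), (S4), the bet (S1) is EXACTLY the Riemann hypothesis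
  (`stub_shadowCore_iff_riemannHypothesis`) — and the radical block, the gap and the `√ε` residual carry no logical weight
  in it (the empty block realises (S1) under RH);
* and the unconditional stubs are logically IDLE even for the line's calibration `diniLeakage_of_strictFloor`: a strict floor
  on every compact range gives the crux with NO stub at all (`diniLeakage_of_strictFloor_stubFree`: floor ⟹ `ε ≥ 0` ⟹ Weil
  positivity at every window ⟹ RH (`riemannHypothesis_iff_forall_weilPositivityOn`) ⟹ crux).
So the line cannot close the crux short of proving RH, and what it would land on the way ((S0) radical identity, (S2) boundary
law, (S3) shadow edge mass) serves no obligation of this crux any more (the regularity half `WindowLipschitz` is a tree theorem,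
`WindowLipschitz_proof`).  It is the crux — i.e. the summit — in costume.  No stub of this line is refuted. -/

namespace Summit.RiemannHypothesis.RiemannHypothesis.Cruxes.DiniLeakage.RadicalShadowSlepianEdge

open MeasureTheory Set Filter
open Literature.NumberTheory.LFunctions
open Summit.RiemannHypothesis.RiemannHypothesis.Theses.WeilWindowFlow (DiniLeakage)

/-- Under RH the window bottom has a strict positive floor on every compact window range (`strictUnderRH_proof`, item 1043,
and antitonicity `eps_antitone`: the floor is `ε(A)`). -/
theorem strictFloor_of_riemannHypothesis (hRH : _root_.RiemannHypothesis) :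
    ∀ b₀ A : ℝ, 0 < b₀ → b₀ ≤ A → ∃ c : ℝ, 0 < c ∧ ∀ a : ℝ, b₀ ≤ a → a ≤ A → c ≤ weilGroundEnergy a := by
  intro b₀ A hb₀ hb₀A
  have hA : 0 < A := lt_of_lt_of_le hb₀ hb₀A
  refine ⟨weilGroundEnergy A,
    _root_.Summit.RiemannHypothesis.RiemannHypothesis.Theorems.strictUnderRH_proof
      ((_root_.Summit.RiemannHypothesis_iff).2 hRH) A hA, fun a ha haA ↦ ?_⟩
  exact eps_antitone (lt_of_lt_of_le hb₀ ha) haA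

/-- **RH ⟹ the bet (S1), as typed** (empty block). -/
theorem stub_shadowCore_of_riemannHypothesis (hRH : _root_.RiemannHypothesis) : type_of% stub_shadowCore :=
  fun _ ↦ shadowCore_of_strictFloor (strictFloor_of_riemannHypothesis hRH)

/-- **COSTUME CERTIFICATE: the statements of the five registered stubs prove the Riemann hypothesis** (Mathlib's
`RiemannHypothesis`; sorry-free in hypothesis form; the composition `diniLeakage_of_stubs` read through the tree theorem
`diniLeakage_iff_mathlib_riemannHypothesis`). -/
theorem riemannHypothesis_of_stubs
    (h0 : type_of% stub_radicalIdentity) (h1 : type_of% stub_shadowCore) (h2 : type_of% stub_boundaryLaw)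
    (h3 : type_of% stub_shadowEdgeMass) (h4 : type_of% stub_relativeCommutator) : _root_.RiemannHypothesis :=
  (_root_.Summit.RiemannHypothesis.RiemannHypothesis.Theorems.WeilWindowFlowDiniLeakage.diniLeakage_iff_mathlib_riemannHypothesis).1
    (diniLeakage_of_stubs (h1 h0) h2 h3 h4)

/-- **EXACT CALIBRATION OF THE BET: given the four unconditional stubs, (S1) ↔ RiemannHypothesis.** -/
theorem stub_shadowCore_iff_riemannHypothesis
    (h0 : type_of% stub_radicalIdentity) (h2 : type_of% stub_boundaryLaw)
    (h3 : type_of% stub_shadowEdgeMass) (h4 : type_of% stub_relativeCommutator) :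
    (type_of% stub_shadowCore) ↔ _root_.RiemannHypothesis :=
  ⟨fun h1 ↦ riemannHypothesis_of_stubs h0 h1 h2 h3 h4, stub_shadowCore_of_riemannHypothesis⟩

/-- **The unconditional stubs are idle for the calibration**: a strict floor on every compact range gives the crux with
NO stub (floor ⟹ `ε ≥ 0` everywhere ⟹ Weil positivity at every window ⟹ RH ⟹ crux), cf. `diniLeakage_of_strictFloor`
above, which routes the same implication through (S2), (S3), (S4). -/
theorem diniLeakage_of_strictFloor_stubFree
    (hfloor : ∀ b₀ A : ℝ, 0 < b₀ → b₀ ≤ A → ∃ c : ℝ, 0 < c ∧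
      ∀ a : ℝ, b₀ ≤ a → a ≤ A → c ≤ weilGroundEnergy a) : DiniLeakage := by
  refine (_root_.Summit.RiemannHypothesis.RiemannHypothesis.Theorems.WeilWindowFlowDiniLeakage.diniLeakage_iff_mathlib_riemannHypothesis).2 ?_
  refine (_root_.Literature.NumberTheory.LFunctions.riemannHypothesis_iff_forall_weilPositivityOn).2 fun a ha ↦ ?_
  obtain ⟨c, hc, hca⟩ := hfloor a a ha le_rfl
  exact (_root_.Literature.NumberTheory.LFunctions.weilGroundEnergy_nonneg_iff_holds ha).1
    (hc.le.trans (hca a le_rfl le_rfl))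

/-- The skeleton's own zero-hypothesis proof term, read through the calibration: a "proof" of RH whose only gaps are the
five `sorry`s of the stubs (documentation of the costume; `sorryAx` in its cone by construction). -/
theorem riemannHypothesis_of_skeleton : _root_.RiemannHypothesis :=
  riemannHypothesis_of_stubs stub_radicalIdentity stub_shadowCore stub_boundaryLaw stub_shadowEdgeMass
    stub_relativeCommutator

end Summit.RiemannHypothesis.RiemannHypothesis.Cruxes.DiniLeakage.RadicalShadowSlepianEdge
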